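import Mathlib.FieldTheory.Finite.Basic
import Mathlib.LinearAlgebra.Dimension.StrongRankCondition
import HarnessLib

/-!
# The Remarks of [IUTchI] §4 on prime-strips as "sections": 4.3.1 (i)–(iii), 4.3.2, 4.3.3 (i)–(iv) —
# abc-iut cell, layer L5 (wave-2 row W2-L5-02), statements-first

Mochizuki, *Inter-universal Teichmüller theory I: construction of Hodge theaters*, §4 "Multiplicative
Combinatorial Teichmüller Theory", kurims May-2020 manuscript (lit key `paper:url-690e7b3c6199`),
Remarks 4.3.1 (i)–(iii) and 4.3.2 (pp. 101–104), 4.3.3 (i)–(iv) (pp. 104–105) — eight census sub-items,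
each read on the page (companion file `BaseRemarksLabels.lean`: Remarks 4.7.1–4.7.2, 4.9.1–4.9.3).  These
Remarks are COMMENTARY on Example 4.3 (typed by abc-iut-L5-t3 over the hypothesis structure
`BaseThetaDatum`, `BaseBridgeModels.lean`).  Following the layer rule for expository Remarks, each sub-item
gets a `/-! -/` section carrying its locator; where a sub-item states a CHECKABLE mechanism it is typed as
a small theorem over Mathlib and PROVED; pure prose is transcribed/summarised in the section docstring and
carries no declaration (census status "noted").  What is proved here:

* Rmk 4.3.1 (i) / (ii)(a): "the morphism `Spec(K) → Spec(F)` [equivalently `F ↪ K`] does not admit a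
  section": a field extension `F ↪ K` that is not surjective admits no `F`-algebra homomorphism
  `K → F` (`Rmk431.no_section`), in particular none when `[K : F] > 1` or when `K/F` has a non-trivial
  automorphism (as the `K` of Def. 3.1 does by Def. 3.1 (d)); and no ring homomorphism `K → F`
  restricts to the identity of `F` (`Rmk431.no_ringHom_retraction`).

NOT typed (prose only, see the sections): Rmk 4.3.1 (ii)(b)(c) (prime decomposition trees,
Neukirch–Uchida; the group-theoretic reading of (c) — no continuous retraction `G_F → G_K` of the
inclusion `G_K ↪ G_F` for number fields `F ⊊ K` — would follow from the slimness of `G_F` and belongs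
with the absolute-Galois-group vocabulary of layer L4), 4.3.1 (iii), 4.3.2 (requirements (a)(b)(c) on
the "desired geometry"), 4.3.3 (i)–(iv) (the analogy with the upper half-plane; the Poincaré metric
`κ_ℍ = (1/2πi) ∂∂̄ log(|f|²_ω)` needs Kähler-metric vocabulary absent from Mathlib).  The number-theoretic
input cited in print ([NSW] Chapter XII §2) is not formalised.

Imports: Mathlib only.  Record-only; the bibliographic key of the series carries the D-0012 status, hence
the tag form [claim: Mochizuki2012, status: disputed] on every declaration; nothing here takes a side on
[IUTchIII] Cor. 3.12; typed ≠ discharged.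
-/

namespace Literature.IUT.HodgeTheaters

/-! ### Remark 4.3.1 (i) ([IUTchI] p. 101): prime-strips as "sections" of `Spec(K) → Spec(F)`

"Suppose, for simplicity, … that `F = F_mod`.  Note that the morphism of schemes `Spec(K) → Spec(F)` [or,
equivalently, the homomorphism of rings `F ↪ K`] does not admit a section.  This nonexistence of a section
is closely related to the nonexistence of a "global multiplicative subspace" of the sort discussed in
[HASurII], Remark 3.7" — the principal obstruction to applying scheme-theoretic Hodge–Arakelov theory to
diophantine geometry; the [`𝒟`-]prime-strips of Example 4.3 define, via the arrows `φ^NF_j` of Example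
4.3 (iv), "arithmetic collections of local analytic sections" of `Spec(K) → Spec(F)` (Fig. 4.1: prime-strips
as "sections", `Gal(K/F) ⊆ GL₂(F_l)`), each yielding an "arithmetic local-analytic global multiplicative
subspace" and "global canonical generator" (cf. Rmk 4.9.1 (i)).  The one checkable assertion — no section
— is proved below for any field extension `F ↪ K` that is not an isomorphism; for the `K` of Definition
3.1 (the field generated over `F` by the `l`-torsion of `E_F`, with `Gal(K/F)` containing `SL₂(F_l)` by
Def. 3.1 (d)) the hypothesis holds because `K/F` has a non-trivial automorphism
(`Rmk431.no_section_of_exists_aut`). -/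

namespace Rmk431

variable {F K : Type*} [Field F] [Field K] [Algebra F K]

/-- An `F`-algebra homomorphism `φ : K → F` out of a field forces `F ↪ K` to be surjective: `φ` is
injective and `φ (algebraMap F K (φ x)) = φ x`. ([IUTchI] Rmk 4.3.1 (i), p. 101, mechanism.)
[claim: Mochizuki2012, status: disputed] -/
theorem algebraMap_surjective_of_algHom (φ : K →ₐ[F] F) :
    Function.Surjective (algebraMap F K) := fun x =>
  ⟨φ x, (φ : K →+* F).injective (by simp)⟩

/-- **Remark 4.3.1 (i)** ([IUTchI] p. 101): "the morphism of schemes `Spec(K) → Spec(F)` [or, equivalently,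
the homomorphism of rings `F ↪ K`] does not admit a section" — for any field extension `F ↪ K` that is not
surjective there is no `F`-algebra homomorphism `K → F`. [claim: Mochizuki2012, status: disputed] -/
theorem no_section (h : ¬ Function.Surjective (algebraMap F K)) : IsEmpty (K →ₐ[F] F) :=
  ⟨fun φ => h (algebraMap_surjective_of_algHom φ)⟩

/-- Remark 4.3.1 (i), degree form ([IUTchI] p. 101): if `[K : F] > 1` (finite rank at least `2`), then
`Spec(K) → Spec(F)` has no section. [claim: Mochizuki2012, status: disputed] -/
theorem no_section_of_one_lt_finrank (h : 1 < Module.finrank F K) : IsEmpty (K →ₐ[F] F) := by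
  refine no_section fun hs => ?_
  have e : F ≃ₐ[F] K :=
    AlgEquiv.ofBijective (Algebra.ofId F K) ⟨(algebraMap F K).injective, hs⟩
  have : Module.finrank F K = 1 := by
    rw [← e.toLinearEquiv.finrank_eq, Module.finrank_self]
  omega

/-- Remark 4.3.1 (i), Galois form ([IUTchI] p. 101 with Def. 3.1 (d) p. 62: `Gal(K/F)` surjects onto a group
containing `SL₂(F_l)`, so `K/F` has a non-trivial automorphism): a field extension with a non-trivial
`F`-automorphism admits no section `K → F`. [claim: Mochizuki2012, status: disputed] -/
theorem no_section_of_exists_aut (h : ∃ σ : K ≃ₐ[F] K, σ ≠ AlgEquiv.refl) : IsEmpty (K →ₐ[F] F) := by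
  refine no_section fun hs => ?_
  obtain ⟨σ, hσ⟩ := h
  refine hσ (AlgEquiv.ext fun x => ?_)
  obtain ⟨r, rfl⟩ := hs x
  simp

/-! ### Remark 4.3.1 (ii) ([IUTchI] pp. 101–102): three points of view on the failure of arithmetic holomorphicity

"The way in which these "arithmetic local-analytic sections" constituted by the [`𝒟`-]prime-strips fail to be
[globally] "arithmetically holomorphic" may be understood from several closely related points of view":
(a) "these sections fail to extend to ring homomorphisms `K → F`" (typed: `no_ringHom_retraction`);
(b) [prime decomposition trees, Fig. 4.2] "an isomorphism, or identification, between `v` [i.e., a prime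
of `F`] and `v'` [i.e., a prime of `K`] which [manifestly — cf., e.g., [NSW], Theorem 12.2.5] fails to
extend to an isomorphism between the respective prime decomposition trees over `v` and `v'`" — reminiscent
of [IUTchIV] §3 (artificial solutions of "`a ∈ a`", Rmk 3.3.1 (i)); (c) "although the "arithmetic
local-analytic sections" … involve isomorphisms of the various local absolute Galois groups, these
isomorphisms of local absolute Galois groups fail to extend to a section of global absolute Galois groups
`G_F ↠ G_K` [i.e., a section of the natural inclusion `G_K ↪ G_F`]"; "by the Neukirch–Uchida theorem
[cf. [NSW], Chapter XII, §2], one may think of (a) and (c) as essentially equivalent", and (b) is closely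
related since the proof of Neukirch–Uchida "depends in an essential fashion on a careful analysis of the
prime decomposition trees".  (b) and (c) are prose here (NOT typed): (b) names no precise statement; the
natural group-theoretic reading of (c) — no continuous homomorphism `G_F → G_K` restricting to the identity
on `G_K`, for number fields `F ⊊ K` — is a consequence of the slimness of `G_F` and is left to the
absolute-Galois-group layer (abc-iut L4). -/

/-- **Remark 4.3.1 (ii)(a)** ([IUTchI] p. 101): "these sections fail to extend to ring homomorphisms `K → F`"
— no ring homomorphism `K → F` restricts to the identity on `F`, as soon as `F ↪ K` is not surjective.
[claim: Mochizuki2012, status: disputed] -/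
theorem no_ringHom_retraction (h : ¬ Function.Surjective (algebraMap F K)) (φ : K →+* F) :
    φ.comp (algebraMap F K) ≠ RingHom.id F := by
  intro hφ
  refine (no_section h).false { φ with commutes' := fun r => ?_ }
  simpa using RingHom.congr_fun hφ r

end Rmk431

/-! ### Remark 4.3.1 (iii) ([IUTchI] p. 102) — expository, no declaration ("noted")

"In some sense, understanding more precisely the content of the failure of these "arithmetic local-analytic
sections" constituted by the `𝒟`-prime-strips to be "arithmetically holomorphic" is a central theme of the
theory of the present series of papers — a theme which is very much in line with the spirit of classical
complex Teichmüller theory." -/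

/-! ### Remark 4.3.2 ([IUTchI] pp. 102–104) — expository, no declaration ("noted")

The incompatibility of the "arithmetic local-analytic sections" of Rmk 4.3.1 (i) with global prime
distributions and global absolute Galois groups (Rmk 4.3.1 (ii)) is "precisely the technical obstacle that
will necessitate the application — in [IUTchIII] — of the absolute `p`-adic mono-anabelian geometry developed
in [AbsTopIII], in the form of "panalocalization along the various prime-strips""; the "desired geometry" must
also be "compatible with globalization" (Fig. 4.3: local geometries at `v, v', v''` ← global geometry; cf.
[IUTchII] Rmk 4.11.2 (iii), [AbsTopIII] Rmk 3.7.6 (iii), (v)) and "based on "étale-like structures"" so as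
to give canonical splittings as in the étale-picture of Cor. 3.9 (i).  Summary of the requirements:
(a) local independence of global structures, (b) globalizability, in a fashion that is independent of local
structures, (c) the property of being based on étale-like structures; "(a), (b) at first glance almost appear
to contradict one another" (function-field case: descent to the base field); that the mono-anabelian geometry
of [AbsTopIII] satisfies (a), (b), (c) is "a highly nontrivial consequence" of that theory ([AbsTopIII] §I1).
No mathematical statement about the objects of §4 is made; nothing to type. -/

/-! ### Remark 4.3.3 (i) ([IUTchI] p. 104) — expository, no declaration ("noted")

The analogy between the mono-anabelian theory of [AbsTopIII] and the theory of Frobenius-invariant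
indigenous bundles of `p`-adic Teichmüller theory ([AbsTopIII] §I5), composed with the analogy between the
`p`-adic and complex theories ([pOrd], [pTeich] Introductions), gives an analogy between mono-anabelian
theory and "the classical geometry of the upper half-plane `ℍ`", which "revolves around the canonical Kähler
metric — i.e., the Poincaré metric" and thereby "renders more transparent the relationship … [with]
classical Arakelov theory". -/

/-! ### Remark 4.3.3 (ii) ([IUTchI] pp. 104–105) — expository, no declaration ("noted")

The content of [AbsTopIII] summarised by the diagram `Π ↷ k̄^× —log→ k̄ ↶ Π  (∗)` (`k/ℚ_p` finite, `Π` the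
arithmetic fundamental group of a hyperbolic orbicurve over `k`, `log` the `p`-adic logarithm).  On `ℍ`: the
tautological indigenous bundle `(ℰ, ∇_ℰ)` (first de Rham cohomology of the tautological elliptic curve), its
Hodge filtration `0 → ω → ℰ → τ → 0` with `τ := ω⁻¹`, the complex conjugation `ι_ℰ`, the Hermitian metric
`|−|_ω` on `ω` from `ω ↪ ℰ —ι_ℰ→ ℰ ↠ τ`, and, for a trivializing section `f` of `ω`, the `(1,1)`-form
`κ_ℍ := (1/2πi) ∂∂̄ log(|f|²_ω)` = "the canonical Kähler metric [i.e., Poincaré metric] on `ℍ`".  Formal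
similarities with `(∗)`: `log` ↔ the log-Frobenius operation; `Π` ↔ `∂̄` ("Galois groups are arithmetic
tangent bundles", [HASurI]); `Π` on the opposite side of `log` ↔ `∂` (complex conjugation as "archimedean
Frobenius"); the ring structures of the copies of `k` on either side of `log` ↔ the Hodge filtration of `ℰ`
([AbsTopIII] Rmk 3.7.2); log-shells as "canonical rigid integral structures"/"canonical standard units of
volume" ↔ `κ_ℍ` "determining a canonical notion of volume on `ℍ`".  NOT typed: the identity "`κ_ℍ` is the
Poincaré metric" is classical (curvature form of the Hodge bundle on `ℍ`) but needs Kähler-metric / line-bundle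
vocabulary on `ℍ` absent from Mathlib; it plays no role in the logical structure of §4. -/

/-! ### Remark 4.3.3 (iii) ([IUTchI] p. 105) — expository, no declaration ("noted")

Under the analogy of (ii): requirement (a) of Rmk 4.3.2 ↔ "the local representability via the [positive]
`(1,1)`-form `κ_ℍ` — on, say, a compact quotient `S` of `ℍ` — of the [positive] global degree of [the descent
to `S` of] the line bundle `ω`"; requirement (b) ↔ the fact that this `(1,1)`-form "not only exists locally on
`S`, but also admits a canonical global extension to the entire Riemann surface `S` which may be related to
the algebraic theory" of rational functions on `S`. -/

/-! ### Remark 4.3.3 (iv) ([IUTchI] p. 105) — expository, no declaration ("noted")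

The dictionary, verbatim: mono-anabelian theory ↔ geometry of the upper half-plane `ℍ`; the Galois group `Π`
↔ the differential operator `∂̄`; the Galois group `Π` on the opposite side of `log` ↔ the differential operator
`∂`; the ring structures of the copies of `k` on either side of `log` ↔ the Hodge filtration of `ℰ`, `ι_ℰ`,
`|−|_ℰ`; log-shells as canonical units of volume ↔ the canonical Kähler volume `κ_ℍ`. -/

end Literature.IUT.HodgeTheaters
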